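import Summits.QuantumAdvantage.QuantumAdvantage.Theorems.CubicForrelationNearExactIsExactTwelveLevelSixEFlat
import Summits.QuantumAdvantage.QuantumAdvantage.Theorems.CubicForrelationNearExactIsExactFlatRadical
import Summits.QuantumAdvantage.QuantumAdvantage.Theorems.CubicForrelationNearExactIsExactEighteenPairing
import Summits.QuantumAdvantage.QuantumAdvantage.Theorems.CubicForrelationNearExactIsExactTwelveWildParity

/-!
# Crux `CubicForrelation.NearExactIsExact` (stmt-QuantumAdvantage-14043) — n = 12 AT `Φ = 29/32`, configuration (β): (H3)/(H4) on every FIBRE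
  `x₀ ⊕ P` of the even set (`P` = its period group), hence the sign is quadratic of rank `≤ 2` along each fibre

Certificate seat `b2b-cforr-cert` (gen 25).  HONEST FRAMING: finite-slice structure lemmas (standard axioms) about cubic Boolean pairs on 12 bits;
third brick for configuration (β) × (β) (plan HOME/b2b-cforr-cert-g25/PLAN-N12-928-BETA.md).  With `tw26_weight768_periods` (`#P = 128`) it says:
on each of the six 7-flat fibres of `Z` the residual sign `σ` is `±(−1)^{ℓℓ' ⊕ affine}`.  It does NOT decide (β) and claims NO value of `θ₁₂`.
NOT summit progress.

Setting: cubic `f, g`, `W_g = 64u''`, `Z = {u'' even}`, `e = u'' − (−1)^f` VANISHING OFF `Z` (configuration (β)), `#Z < 1024`;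
`P = {a : Z ⊕ a = Z}` (periods of `Z`; xor-closed).
* `tb27_fibre_H34`: for `x ∈ Z` and directions in `P`: `4 ∣ Σ_{3-flat} e`, `8 ∣ Σ_{4-flat} e`.  (Three outer directions whose seven combinations
  avoid `Z ⊕ x` — pure counting, `4·#Z < 4096`, `ep_dirs3` — put all seven translates of the inner flat off `Z`, where `e = 0`; `ep_loc3` +
  `tw15_e_flat6/7`.)
* `tb27_fibre_radical`: consequently, for a sign `hb` with `sZ∘hb = e` on `Z`, the relative form of `hb` along the fibre `x₀ ⊕ P` has radical `R`
  with `#P ≤ 4·#R` (`fr_radical_large`) — rank `≤ 2` on every fibre.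

References: MacWilliams–Sloane (1977) Ch. 13 §3, Ch. 15 §2; C. Carlet (2021) §5.2.  Axioms: the standard three.
-/

set_option linter.dupNamespace false -- D-0017: single-problem summit ⇒ `QuantumAdvantage.QuantumAdvantage` by design

noncomputable section

namespace Summit.QuantumAdvantage.QuantumAdvantage.Theorems.CubicForrelation.NearExactIsExact

open Finset
open Literature.Computability.QuantumComplexity
open Literature.Computability.QuantumComplexity.BuzetChailloux (bxor zeroVec bxor_bxor_cancel_left bxor_zeroVec zeroVec_bxor bxor_comm
  bxor_self)
open Literature.Computability.QuantumComplexity.DerivativeWalsh (W)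

/-- **(H3)/(H4) on the fibres of the even set in configuration (β).**  Cubic `f, g`, `W_g = 64u''`, `Z = {u'' even}` with `#Z < 1024`, residual
`e = u'' − (−1)^f` vanishing off `Z`, `P` the period group of `Z`: every parametrised 3-flat (resp. 4-flat) sum of `e` with base point in `Z` and
directions in `P` is `≡ 0 (mod 4)` (resp. `mod 8`). [this work] -/
theorem tb27_fibre_H34 (f g : (Fin (6 + 6) → Bool) → Bool) (hf : IsDegLeFun 3 f) (hg : IsDegLeFun 3 g)
    (u'' : (Fin (6 + 6) → Bool) → ℤ) (hu'' : ∀ x, W (fun y => signOf (g y)) x = (2 : ℝ) ^ 6 * (u'' x : ℝ))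
    (hZlt : #(univ.filter fun x : Fin (6 + 6) → Bool => ¬ Odd (u'' x)) < 1024)
    (hoff0 : ∀ y, y ∉ (univ.filter fun x : Fin (6 + 6) → Bool => ¬ Odd (u'' x)) → u'' y - sZ (f y) = 0) :
    (∀ x ∈ (univ.filter fun x : Fin (6 + 6) → Bool => ¬ Odd (u'' x)), ∀ a b c : Fin (6 + 6) → Bool,
      a ∈ (univ.filter fun a : Fin (6 + 6) → Bool => ∀ x, decide (Odd (u'' (bxor x a))) = decide (Odd (u'' x))) →
      b ∈ (univ.filter fun a : Fin (6 + 6) → Bool => ∀ x, decide (Odd (u'' (bxor x a))) = decide (Odd (u'' x))) →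
      c ∈ (univ.filter fun a : Fin (6 + 6) → Bool => ∀ x, decide (Odd (u'' (bxor x a))) = decide (Odd (u'' x))) →
      (4 : ℤ) ∣ ∑ ε : Fin 3 → Bool, (u'' (fun j => x j ^^ decide (Odd #(univ.filter fun i =>
        ε i && (![a, b, c] : Fin 3 → Fin (6 + 6) → Bool) i j))) - sZ (f (fun j => x j ^^ decide (Odd #(univ.filter fun i =>
        ε i && (![a, b, c] : Fin 3 → Fin (6 + 6) → Bool) i j)))))) ∧
    (∀ x ∈ (univ.filter fun x : Fin (6 + 6) → Bool => ¬ Odd (u'' x)), ∀ a₀ a₁ a₂ a₃ : Fin (6 + 6) → Bool,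
      a₀ ∈ (univ.filter fun a : Fin (6 + 6) → Bool => ∀ x, decide (Odd (u'' (bxor x a))) = decide (Odd (u'' x))) →
      a₁ ∈ (univ.filter fun a : Fin (6 + 6) → Bool => ∀ x, decide (Odd (u'' (bxor x a))) = decide (Odd (u'' x))) →
      a₂ ∈ (univ.filter fun a : Fin (6 + 6) → Bool => ∀ x, decide (Odd (u'' (bxor x a))) = decide (Odd (u'' x))) →
      a₃ ∈ (univ.filter fun a : Fin (6 + 6) → Bool => ∀ x, decide (Odd (u'' (bxor x a))) = decide (Odd (u'' x))) →
      (8 : ℤ) ∣ ∑ ε : Fin 4 → Bool, (u'' (fun j => x j ^^ decide (Odd #(univ.filter fun i =>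
        ε i && (![a₀, a₁, a₂, a₃] : Fin 4 → Fin (6 + 6) → Bool) i j))) - sZ (f (fun j => x j ^^ decide (Odd #(univ.filter fun i =>
        ε i && (![a₀, a₁, a₂, a₃] : Fin 4 → Fin (6 + 6) → Bool) i j)))))) := by
  classical
  set Z := univ.filter (fun x : Fin (6 + 6) → Bool => ¬ Odd (u'' x)) with hZdef
  have hmemZ : ∀ x, x ∈ Z ↔ ¬ Odd (u'' x) := fun x => by simp [hZdef]
  set P := (univ.filter fun a : Fin (6 + 6) → Bool => ∀ x, decide (Odd (u'' (bxor x a))) = decide (Odd (u'' x))) with hPdef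
  set e : (Fin (6 + 6) → Bool) → ℤ := fun x => u'' x - sZ (f x) with hedef
  change ∀ y, y ∉ Z → e y = 0 at hoff0
  -- `P` is an xor-closed group of periods of `Z`
  have hP0 : zeroVec ∈ P := mem_filter.2 ⟨mem_univ _, fun x => by rw [bxor_zeroVec]⟩
  have hPadd : ∀ a ∈ P, ∀ b ∈ P, bxor a b ∈ P := by
    intro a ha b hb
    refine mem_filter.2 ⟨mem_univ _, fun x => ?_⟩
    rw [← iw_bxor_assoc, (mem_filter.1 hb).2, (mem_filter.1 ha).2]
  have hper : ∀ q ∈ P, ∀ y, y ∈ Z ↔ bxor y q ∈ Z := by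
    intro q hq y
    have h := (mem_filter.1 hq).2 y
    rw [hmemZ, hmemZ]
    constructor
    · intro hy hodd; exact hy (by have := decide_eq_true hodd; rw [h] at this; exact of_decide_eq_true this)
    · intro hy hodd; exact hy (by have := decide_eq_true hodd; rw [← h] at this; exact of_decide_eq_true this)
  -- flat points with base `x` and directions in `P` are `x ⊕ q`, `q ∈ P`
  have hflat : ∀ {k : ℕ} (x : Fin (6 + 6) → Bool) (a : Fin k → Fin (6 + 6) → Bool), (∀ i, a i ∈ P) → ∀ ε : Fin k → Bool,
      ∃ q ∈ P, (fun j => x j ^^ decide (Odd #(univ.filter fun i => ε i && a i j))) = bxor x q := by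
    intro k x a ha ε
    refine ⟨(fun j => zeroVec j ^^ decide (Odd #(univ.filter fun i => ε i && a i j))), ?_, ws_flatPt_eq_bxor x a ε⟩
    exact ws_flatPt_mem P hP0 (· ∈ P) (fun y hy b hb => hPadd y hy b hb) k zeroVec hP0 a ha ε
  -- translating a flat point by `t ∉ Z ⊕ x` leaves `Z`
  have hout : ∀ x ∈ Z, ∀ q ∈ P, ∀ t, t ∉ Z.image (bxor x) → bxor (bxor x q) t ∉ Z := by
    intro x hx q hq t ht hmem
    apply ht
    have h1 : bxor (bxor (bxor x q) t) q ∈ Z := (hper q hq _).1 hmem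
    have e1 : bxor (bxor (bxor x q) t) q = bxor x t := by
      funext j; simp only [bxor]; cases x j <;> cases q j <;> cases t j <;> rfl
    rw [e1] at h1
    exact mem_image.2 ⟨bxor x t, h1, by rw [bxor_bxor_cancel_left]⟩
  -- three outer directions for a base point `x ∈ Z`
  have hdirs : ∀ x ∈ Z, ∃ t₁ t₂ t₃ : Fin (6 + 6) → Bool,
      t₁ ∉ Z.image (bxor x) ∧ t₂ ∉ Z.image (bxor x) ∧ bxor t₂ t₁ ∉ Z.image (bxor x) ∧ t₃ ∉ Z.image (bxor x) ∧
      bxor t₃ t₁ ∉ Z.image (bxor x) ∧ bxor t₃ t₂ ∉ Z.image (bxor x) ∧ bxor t₃ (bxor t₂ t₁) ∉ Z.image (bxor x) := by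
    intro x hx
    obtain ⟨t₁, -, t₂, -, t₃, -, n1, n2, n21, n3, n31, n32, n321⟩ := ep_dirs3 univ (Z.image (bxor x)) (by
      have h1 : #(Z.image (bxor x)) ≤ #Z := card_image_le
      rw [card_univ, Fintype.card_fun, Fintype.card_bool, Fintype.card_fin]; norm_num; omega)
    exact ⟨t₁, t₂, t₃, n1, n2, n21, n3, n31, n32, n321⟩
  -- localisation on a flat with base `x ∈ Z` and directions in `P`
  have hloc : ∀ {k : ℕ} (x : Fin (6 + 6) → Bool), x ∈ Z → ∀ (a : Fin k → Fin (6 + 6) → Bool), (∀ i, a i ∈ P) →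
      ∃ t₁ t₂ t₃ : Fin (6 + 6) → Bool,
      ∑ ε : Fin (k + 3) → Bool, e (fun j => x j ^^ decide (Odd #(univ.filter fun i =>
          ε i && (Matrix.vecCons t₁ (Matrix.vecCons t₂ (Matrix.vecCons t₃ a)) : Fin (k + 3) → Fin (6 + 6) → Bool) i j))) =
      ∑ ε : Fin k → Bool, e (fun j => x j ^^ decide (Odd #(univ.filter fun i => ε i && a i j))) := by
    intro k x hx a ha
    obtain ⟨t₁, t₂, t₃, n1, n2, n21, n3, n31, n32, n321⟩ := hdirs x hx
    have hz : ∀ ε : Fin k → Bool, ∀ w, w ∉ Z.image (bxor x) →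
        e (bxor (fun j => x j ^^ decide (Odd #(univ.filter fun i => ε i && a i j))) w) = 0 := by
      intro ε w hw
      obtain ⟨q, hq, hpt⟩ := hflat x a ha ε
      rw [hpt]
      exact hoff0 _ (hout x hx q hq w hw)
    refine ⟨t₁, t₂, t₃, ep_loc3 e x t₁ t₂ t₃ a (fun ε => hz ε t₁ n1) (fun ε => hz ε t₂ n2)
      (fun ε => by rw [iw_bxor_assoc]; exact hz ε _ n21) (fun ε => hz ε t₃ n3)
      (fun ε => by rw [iw_bxor_assoc]; exact hz ε _ n31) (fun ε => by rw [iw_bxor_assoc]; exact hz ε _ n32)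
      (fun ε => by rw [iw_bxor_assoc, iw_bxor_assoc]; exact hz ε _ n321)⟩
  refine ⟨?_, ?_⟩
  · intro x hx a b c ha hb hc
    obtain ⟨t₁, t₂, t₃, hl⟩ := hloc x hx ![a, b, c] (fun i => by fin_cases i <;> assumption)
    have h6 := tw15_e_flat6 f g hf hg u'' hu'' x ![t₁, t₂, t₃, a, b, c]
    change (4 : ℤ) ∣ ∑ ε : Fin (3 + 3) → Bool, e (fun j => x j ^^ decide (Odd #(univ.filter fun i =>
        ε i && (Matrix.vecCons t₁ (Matrix.vecCons t₂ (Matrix.vecCons t₃ ![a, b, c])) : Fin (3 + 3) → Fin (6 + 6) → Bool) i j))) at h6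
    rw [hl] at h6
    exact h6
  · intro x hx a₀ a₁ a₂ a₃ ha₀ ha₁ ha₂ ha₃
    obtain ⟨t₁, t₂, t₃, hl⟩ := hloc x hx ![a₀, a₁, a₂, a₃] (fun i => by fin_cases i <;> assumption)
    have h7 := tw15_e_flat7 f g hf hg u'' hu'' x ![t₁, t₂, t₃, a₀, a₁, a₂, a₃]
    change (8 : ℤ) ∣ ∑ ε : Fin (4 + 3) → Bool, e (fun j => x j ^^ decide (Odd #(univ.filter fun i =>
        ε i && (Matrix.vecCons t₁ (Matrix.vecCons t₂ (Matrix.vecCons t₃ ![a₀, a₁, a₂, a₃])) : Fin (4 + 3) → Fin (6 + 6) → Bool) i j))) at h7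
    rw [hl] at h7
    exact h7

/-- **Rank `≤ 2` on every fibre.**  In the situation of `tb27_fibre_H34`, if `hb` is a sign with `sZ(hb x) = e(x)` on `Z` and `x₀ ∈ Z`, then the
radical `R` of the relative form of `hb` along the fibre `x₀ ⊕ P` (a subgroup of the period group `P`) satisfies `#P ≤ 4·#R`. [this work] -/
theorem tb27_fibre_radical (f g : (Fin (6 + 6) → Bool) → Bool) (hf : IsDegLeFun 3 f) (hg : IsDegLeFun 3 g)
    (u'' : (Fin (6 + 6) → Bool) → ℤ) (hu'' : ∀ x, W (fun y => signOf (g y)) x = (2 : ℝ) ^ 6 * (u'' x : ℝ))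
    (hZlt : #(univ.filter fun x : Fin (6 + 6) → Bool => ¬ Odd (u'' x)) < 1024)
    (hoff0 : ∀ y, y ∉ (univ.filter fun x : Fin (6 + 6) → Bool => ¬ Odd (u'' x)) → u'' y - sZ (f y) = 0)
    (hb : (Fin (6 + 6) → Bool) → Bool)
    (hhb : ∀ x ∈ (univ.filter fun x : Fin (6 + 6) → Bool => ¬ Odd (u'' x)), sZ (hb x) = u'' x - sZ (f x))
    (x₀ : Fin (6 + 6) → Bool) (hx₀ : x₀ ∈ (univ.filter fun x : Fin (6 + 6) → Bool => ¬ Odd (u'' x))) :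
    #(univ.filter fun a : Fin (6 + 6) → Bool => ∀ x, decide (Odd (u'' (bxor x a))) = decide (Odd (u'' x))) ≤
      4 * #((univ.filter fun a : Fin (6 + 6) → Bool => ∀ x, decide (Odd (u'' (bxor x a))) = decide (Odd (u'' x))).filter fun a =>
        ∀ b ∈ (univ.filter fun a : Fin (6 + 6) → Bool => ∀ x, decide (Odd (u'' (bxor x a))) = decide (Odd (u'' x))),
          (hb x₀ ^^ hb (bxor x₀ a) ^^ hb (bxor x₀ b) ^^ hb (bxor (bxor x₀ a) b)) = false) := by
  classical
  set Z := univ.filter (fun x : Fin (6 + 6) → Bool => ¬ Odd (u'' x)) with hZdef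
  have hmemZ : ∀ x, x ∈ Z ↔ ¬ Odd (u'' x) := fun x => by simp [hZdef]
  set P := (univ.filter fun a : Fin (6 + 6) → Bool => ∀ x, decide (Odd (u'' (bxor x a))) = decide (Odd (u'' x))) with hPdef
  have hPadd : ∀ a ∈ P, ∀ b ∈ P, bxor a b ∈ P := by
    intro a ha b hb
    refine mem_filter.2 ⟨mem_univ _, fun x => ?_⟩
    rw [← iw_bxor_assoc, (mem_filter.1 hb).2, (mem_filter.1 ha).2]
  have hper : ∀ q ∈ P, ∀ y, y ∈ Z → bxor y q ∈ Z := by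
    intro q hq y hy
    have h := (mem_filter.1 hq).2 y
    rw [hmemZ] at hy ⊢
    intro hodd; exact hy (by have := decide_eq_true hodd; rw [h] at this; exact of_decide_eq_true this)
  obtain ⟨H3, H4⟩ := tb27_fibre_H34 f g hf hg u'' hu'' hZlt hoff0
  -- the fibre predicate
  set Q : (Fin (6 + 6) → Bool) → Prop := fun x => x ∈ Z ∧ bxor x₀ x ∈ P with hQdef
  have hQx₀ : Q x₀ := ⟨hx₀, by rw [bxor_self]; exact mem_filter.2 ⟨mem_univ _, fun x => by rw [bxor_zeroVec]⟩⟩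
  have hQV : ∀ x, Q x → ∀ a ∈ P, Q (bxor x a) := fun x hx a ha =>
    ⟨hper a ha x hx.1, by rw [← iw_bxor_assoc]; exact hPadd _ hx.2 _ ha⟩
  have hVQ : ∀ x, Q x → bxor x₀ x ∈ P := fun x hx => hx.2
  have H3σ : ∀ x, Q x → ∀ a b c : Fin (6 + 6) → Bool, a ∈ P → b ∈ P → c ∈ P →
      (4 : ℤ) ∣ ∑ ε : Fin 3 → Bool, sZ (hb (fun j => x j ^^ decide (Odd #(univ.filter fun i => ε i && (![a, b, c] : Fin 3 → Fin (6 + 6) → Bool) i j)))) := by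
    intro x hx a b c ha hb' hc'
    have hmem : ∀ ε : Fin 3 → Bool, (fun j => x j ^^ decide (Odd #(univ.filter fun i => ε i && (![a, b, c] : Fin 3 → Fin (6 + 6) → Bool) i j))) ∈ Z :=
      fun ε => (fr_mem_flatPt3 P (mem_filter.2 ⟨mem_univ _, fun x => by rw [bxor_zeroVec]⟩) Q hQV hx _
        (fun i => by fin_cases i <;> assumption) ε).1
    rw [sum_congr rfl fun ε _ => hhb _ (hmem ε)]
    exact H3 x hx.1 a b c ha hb' hc'
  have H4σ : ∀ x, Q x → ∀ a₀ a₁ a₂ a₃ : Fin (6 + 6) → Bool, a₀ ∈ P → a₁ ∈ P → a₂ ∈ P → a₃ ∈ P →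
      (8 : ℤ) ∣ ∑ ε : Fin 4 → Bool, sZ (hb (fun j => x j ^^ decide (Odd #(univ.filter fun i => ε i && (![a₀, a₁, a₂, a₃] : Fin 4 → Fin (6 + 6) → Bool) i j)))) := by
    intro x hx a₀ a₁ a₂ a₃ ha₀ ha₁ ha₂ ha₃
    have hmem : ∀ ε : Fin 4 → Bool, (fun j => x j ^^ decide (Odd #(univ.filter fun i => ε i && (![a₀, a₁, a₂, a₃] : Fin 4 → Fin (6 + 6) → Bool) i j))) ∈ Z :=
      fun ε => (fr_mem_flatPt4 P (mem_filter.2 ⟨mem_univ _, fun x => by rw [bxor_zeroVec]⟩) Q hQV hx _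
        (fun i => by fin_cases i <;> assumption) ε).1
    rw [sum_congr rfl fun ε _ => hhb _ (hmem ε)]
    exact H4 x hx.1 a₀ a₁ a₂ a₃ ha₀ ha₁ ha₂ ha₃
  exact fr_radical_large P Q x₀ hb hPadd hQx₀ hQV hVQ H3σ H4σ

end Summit.QuantumAdvantage.QuantumAdvantage.Theorems.CubicForrelation.NearExactIsExact

end
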